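import Mathlib.Analysis.SpecialFunctions.SmoothTransition
import Literature.Analysis.FluidPDE.FractionalNSPrescribedEnergy
import Literature.Analysis.FluidPDE.FracLaplacianSmooth
import Literature.Analysis.FluidPDE.FractionalNSTorusTranslate
import Literature.Analysis.FluidPDE.LerayHopfTimeSliceTorus
import HarnessLib

/-!
# Prolongation of local Hölder solutions of the fractional Navier–Stokes system by Leray
  solutions — proofs (Colombo–De Lellis–De Rosa 2018, §1, the remark after Thm. 1.3)

Second sibling proof file of `Literature/Analysis/FluidPDE/FractionalNSPrescribedEnergy` (the first,
`FractionalNSPrescribedEnergyProofs`, discharges De Rosa's Cor. 7.2), definition-free, working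
towards the named fact `ColomboDeLellisDeRosa2018_prolongation` recorded there (Colombo–De Lellis–De Rosa
2018, §1 p. 3: "Each solution in Theorem 1.3 can be prolonged past the time `T` using Theorem 1.1
(note that (NS) is invariant under time-shifts and so Theorem 1.1 is valid with any initial time `T`
substituting `0`)"; De Rosa 2019, end of the proof of Thm. 1.2). The printed argument has two
ingredients — Leray's existence theorem for the fractional system (CDLDR Thm. 1.1, the named fact
`ColomboDeLellisDeRosa2018_thm11` of the statement file) and the concatenation of a local solution
with a Leray solution started at time `T` — and this file PROVES the second and the implication

* `ColomboDeLellisDeRosa2018_prolongation_of_thm11 :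
    ColomboDeLellisDeRosa2018_thm11 → ColomboDeLellisDeRosa2018_prolongation`,

so that the prolongation fact is reduced to Thm. 1.1 exactly as in the source (its discharge
`ColomboDeLellisDeRosa2018_prolongation_holds` then follows from a discharge of Thm. 1.1, a
Galerkin–compactness theory in the manner of the tree's `NSHopfGalerkin*` files for `α = 1`).

## Contents (all proved; general dimension `d` unless stated)

* Translation by `T` on the time axis: a.e. statements, lower and Bochner integrals over
  intervals / half-lines, the measure-preserving shear `(t, y) ↦ (t - T, y)`
  (`ae_restrict_Ioi_comp_sub_right`, `setLIntegral_Ioo_comp_sub_right`,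
  `setIntegral_Ioi_comp_sub_right`, `measurePreserving_prodMap_sub_right_Ioi`, …).
* `Torus.fracLaplacian_const_smul` — `(-Δ)^α (cψ) = c (-Δ)^α ψ`; product test fields `η(t)ψ(t,x)`
  (`Torus.isSpaceTimeTestIoo_smul`, `Torus.timeDeriv_smul'`), time translates of test fields
  (`IsSpaceTimeTest.comp_add_right`).
* The weak-form functional `Φ(t) = ∫ (⟪u, ∂ₜψ⟫ + ⟪u, (u·∇)ψ⟫ - ν⟪u, (-Δ)^α ψ⟫)(t)`: continuity in
  `t` for fields continuous on a slab (`Torus.continuousOn_fracWeakFunctional`), measurability and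
  integrability on `(0, ∞)` for fields in the Leray class `L^∞L²`
  (`Torus.integrableOn_fracWeakFunctional_Ioi` — the fact that makes the Bochner integral of the
  weak formulation with datum a genuine integral).
* `Torus.IsWeakFracNSSolutionOn.setIntegral_Ioc_eq_sub` — **the end-point form of the weak
  identity** for continuous distributional solutions on `[0, T]`:
  `∫_{(0,T]} Φ = ∫⟪v(T), ψ(T)⟫ - ∫⟪v(0), ψ(0)⟫` for every smooth divergence-free `ψ` (interior
  identity tested with `ηθψ`, the tree's du Bois-Reymond lemma
  `Literature.Analysis.FunctionSpaces.eq_add_setIntegral_of_forall_test`, continuity at the end points).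
* `Torus.eSobolevNorm_sq_le_add_eFracDissipation` — `‖v‖²_{H^α} ≤ ‖v‖²_{L²} + ∫|(-Δ)^{α/2}v|²`
  (`(1+|k|²)^α ≤ (4π²|k|²)^α` off the zero mode), and the time-measurability of the dissipation
  (`Torus.aemeasurable_eFracDissipation_of_coeff`): the energy inequality yields `L²_t H^α_x`.
* `Torus.isWeaklyDivFree_of_continuousOn_slab` — weak incompressibility at every time of the closed
  slab from a.e. time (continuity).
* `Torus.IsLerayFracSolution.glue` — **the gluing theorem**: a continuous distributional solution on
  `[0, T]` with the energy inequality for all `0 ≤ s < t ≤ T`, concatenated with a Leray solution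
  from `v(T)`, is a Leray solution from `v(0)` (`Torus.IsLerayFracSolution`).
* `ColomboDeLellisDeRosa2018_prolongation_of_thm11` — the reduction of the prolongation fact to
  Thm. 1.1 (on `𝕋³`).

## Design notes

* Everything is phrased in the solution notions of `FractionalNSTorus` (unit torus, viscosity as a
  parameter `ν` where free, energies in `[0, ∞]`); the Hölder hypothesis of the prolongation fact is
  used only through continuity on the closed slab (`HolderOnWith.continuousOn`).
* The weak formulations are Bochner integrals in time of Bochner integrals in space, so every
  manipulation (splitting at `T`, translating) is preceded by an integrability statement; for the
  Leray continuation this is `Torus.integrableOn_fracWeakFunctional_Ioi` (Fubini measurability from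
  the space–time measurability clause, domination by the `L^∞L²` bound on the time support of the
  test field).

## References

* M. Colombo, C. De Lellis, L. De Rosa, *Ill-posedness of Leray solutions for the hypodissipative
  Navier–Stokes equations*, Comm. Math. Phys. 362 (2018), 659–688 = arXiv:1708.05666, §1 p. 3
  (Thm. 1.1, (2)–(3), Thm. 1.3 and the paragraph after it). [`ColomboDelellisDerosa2018`]
* L. De Rosa, *Infinitely many Leray–Hopf solutions for the fractional Navier–Stokes equations*,
  Comm. PDE 44 (2019), 335–365 = arXiv:1801.10235, §2 (end of the proof of Thm. 1.2). [`Derosa2018`]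
* R. Temam, *Navier–Stokes Equations*, 3rd ed. (1984), Ch. III §1.1, (1.22)–(1.25) (end-point /
  time-sliced forms of the weak formulation); G. P. Galdi, *An introduction to the Navier–Stokes
  initial-boundary value problem* (2000), Lemma 2.1.
-/

noncomputable section

open MeasureTheory Set Filter Topology Function UnitAddTorus
open scoped ENNReal NNReal InnerProductSpace ContDiff

namespace Literature.Analysis.FluidPDE

/-! ## Translation by `T` on the time axis -/

section RealLine

/-- Transport of an a.e. statement along `t ↦ t - T`: if `P` holds a.e. on `(a, b)` then
`P (· - T)` holds a.e. on `(a + T, b + T)` (translation invariance of Lebesgue measure). [folklore] -/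
theorem ae_restrict_Ioo_comp_sub_right {a b : ℝ} (T : ℝ) {P : ℝ → Prop}
    (h : ∀ᵐ t ∂(volume.restrict (Ioo a b)), P t) :
    ∀ᵐ t ∂(volume.restrict (Ioo (a + T) (b + T))), P (t - T) := by
  rw [ae_restrict_iff' measurableSet_Ioo] at h ⊢
  have h2 := (measurePreserving_sub_right volume T).quasiMeasurePreserving.ae h
  filter_upwards [h2] with t ht hts
  exact ht ⟨by linarith [hts.1], by linarith [hts.2]⟩

/-- Transport of an a.e. statement along `t ↦ t - T` on half-lines: if `P` holds a.e. on
`(0, ∞)` then `P (· - T)` holds a.e. on `(T, ∞)`. [folklore] -/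
theorem ae_restrict_Ioi_comp_sub_right (T : ℝ) {P : ℝ → Prop}
    (h : ∀ᵐ t ∂(volume.restrict (Ioi (0 : ℝ))), P t) :
    ∀ᵐ t ∂(volume.restrict (Ioi T)), P (t - T) := by
  rw [ae_restrict_iff' measurableSet_Ioi] at h ⊢
  have h2 := (measurePreserving_sub_right volume T).quasiMeasurePreserving.ae h
  filter_upwards [h2] with t ht hts
  exact ht (Set.mem_Ioi.2 (sub_pos.2 hts))

/-- Change of variables `t ↦ t - T` in a lower integral over an interval:
`∫⁻_{(a+T, b+T)} g(t - T) dt = ∫⁻_{(a, b)} g`. [folklore] -/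
theorem setLIntegral_Ioo_comp_sub_right (g : ℝ → ℝ≥0∞) (a b T : ℝ) :
    ∫⁻ t in Ioo (a + T) (b + T), g (t - T) = ∫⁻ t in Ioo a b, g t := by
  have h1 : ∀ t, (Ioo (a + T) (b + T)).indicator (fun t => g (t - T)) t =
      (Ioo a b).indicator g (t - T) := by
    intro t
    by_cases ht : t ∈ Ioo (a + T) (b + T)
    · rw [indicator_of_mem ht, indicator_of_mem (show t - T ∈ Ioo a b from
        ⟨by linarith [ht.1], by linarith [ht.2]⟩)]
    · rw [indicator_of_notMem ht, indicator_of_notMem]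
      rintro ⟨h₁, h₂⟩
      exact ht ⟨by linarith, by linarith⟩
  rw [← lintegral_indicator measurableSet_Ioo, ← lintegral_indicator measurableSet_Ioo]
  calc ∫⁻ t, (Ioo (a + T) (b + T)).indicator (fun t => g (t - T)) t
      = ∫⁻ t, (Ioo a b).indicator g (t - T) := lintegral_congr h1
    _ = ∫⁻ t, (Ioo a b).indicator g t :=
        lintegral_sub_right_eq_self (μ := (volume : Measure ℝ)) _ T

/-- The translation `t ↦ t - T` carries Lebesgue measure on `(T, ∞)` to Lebesgue measure on
`(0, ∞)`. [folklore] -/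
theorem measurePreserving_sub_right_Ioi (T : ℝ) :
    MeasurePreserving (fun t : ℝ => t - T) (volume.restrict (Ioi T)) (volume.restrict (Ioi 0)) := by
  have h := (measurePreserving_sub_right volume T).restrict_preimage (measurableSet_Ioi (a := (0 : ℝ)))
  have hpre : (fun t : ℝ => t - T) ⁻¹' Ioi 0 = Ioi T := by
    ext t
    simp
  rwa [hpre] at h

/-- Change of variables `t ↦ t - T` in a Bochner integral over a half-line:
`∫_{(T, ∞)} F(t - T) dt = ∫_{(0, ∞)} F`. [folklore] -/
theorem setIntegral_Ioi_comp_sub_right {E : Type*} [NormedAddCommGroup E] [NormedSpace ℝ E]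
    (F : ℝ → E) (T : ℝ) : ∫ t in Ioi T, F (t - T) = ∫ t in Ioi 0, F t :=
  (measurePreserving_sub_right_Ioi T).integral_comp (MeasurableEquiv.subRight T).measurableEmbedding F

/-- Integrability on `(T, ∞)` of `F(· - T)` is integrability of `F` on `(0, ∞)`. [folklore] -/
theorem integrableOn_Ioi_comp_sub_right_iff {E : Type*} [NormedAddCommGroup E] (F : ℝ → E) (T : ℝ) :
    IntegrableOn (fun t => F (t - T)) (Ioi T) ↔ IntegrableOn F (Ioi 0) :=
  (measurePreserving_sub_right_Ioi T).integrable_comp_emb (MeasurableEquiv.subRight T).measurableEmbedding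

/-- The time shear `(t, y) ↦ (t - T, y)` of `ℝ × ℝ^d` carries Lebesgue measure on
`(T, ∞) × ℝ^d` to Lebesgue measure on `(0, ∞) × ℝ^d`. [folklore] -/
theorem measurePreserving_prodMap_sub_right_Ioi {d : Type*} [Fintype d] (T : ℝ) :
    MeasurePreserving (Prod.map (fun t : ℝ => t - T) (id : EuclideanSpace ℝ d → EuclideanSpace ℝ d))
      (volume.restrict (Ioi T ×ˢ univ)) (volume.restrict (Ioi 0 ×ˢ univ)) := by
  have h0 : MeasurePreserving (Prod.map (fun t : ℝ => t - T) (id : EuclideanSpace ℝ d → EuclideanSpace ℝ d))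
      volume volume :=
    (measurePreserving_sub_right volume T).prod (MeasurePreserving.id volume)
  have h := h0.restrict_preimage ((measurableSet_Ioi (a := (0 : ℝ))).prod MeasurableSet.univ)
  have hpre : Prod.map (fun t : ℝ => t - T) (id : EuclideanSpace ℝ d → EuclideanSpace ℝ d) ⁻¹'
      (Ioi 0 ×ˢ univ) = Ioi T ×ˢ univ := by
    ext p
    simp [sub_pos]
  rwa [hpre] at h

end RealLine

namespace Torus

variable {d : Type*} [Fintype d]

/-! ## Linearity of the spectral fractional Laplacian in the field -/

/-- Real parts commute with real scalars written as complex ones: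
`Re ((c : ℂ) • z) = c • Re z` (the real action on `ℂ^d` is the complex one restricted, so this is
`map_smul` of the real-linear `realPart` up to the coercion). [folklore] -/
theorem realPart_coe_smul (c : ℝ) (z : EuclideanSpace ℂ d) :
    FunctionSpaces.EuclideanSpace.realPart ((c : ℂ) • z) = c • FunctionSpaces.EuclideanSpace.realPart z :=
  ContinuousLinearMap.map_smul FunctionSpaces.EuclideanSpace.realPart c z

/-- `(-Δ)^α (c • ψ) = c • (-Δ)^α ψ` for a real constant `c` (linearity of the Fourier
coefficients and of the defining series; no smoothness needed). [folklore] -/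
theorem fracLaplacian_const_smul (α c : ℝ) (ψ : UnitAddTorus d → EuclideanSpace ℝ d) :
    fracLaplacian α (c • ψ) = c • fracLaplacian α ψ := by
  funext x
  have hc : (FunctionSpaces.EuclideanSpace.complexify ∘ (c • ψ)) =
      (c : ℂ) • (FunctionSpaces.EuclideanSpace.complexify ∘ ψ) := by
    funext y
    simp only [comp_apply, Pi.smul_apply, LinearIsometry.map_smul]
    exact RCLike.real_smul_eq_coe_smul (K := ℂ) c _
  rw [fracLaplacian_def, Pi.smul_apply, fracLaplacian_def, hc]
  simp_rw [FunctionSpaces.Torus.mFourierCoeff_const_smul, smul_comm (mFourier _ x) (c : ℂ),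
    smul_comm (fracSymbol α _) (c : ℂ)]
  rw [tsum_const_smul'' (c : ℂ), realPart_coe_smul]

/-- Function form of `fracLaplacian_const_smul`. [folklore] -/
theorem fracLaplacian_fun_const_smul (α c : ℝ) (ψ : UnitAddTorus d → EuclideanSpace ℝ d)
    (x : UnitAddTorus d) :
    fracLaplacian α (fun y => c • ψ y) x = c • fracLaplacian α ψ x := by
  rw [show (fun y => c • ψ y) = c • ψ from rfl, fracLaplacian_const_smul]
  rfl

variable [DecidableEq d]

omit [Fintype d] [DecidableEq d] in
/-- The convective derivative along `u` of the zero field vanishes. [folklore] -/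
theorem convect_pi_zero_right {F : Type*} [NormedAddCommGroup F] [NormedSpace ℝ F]
    (u : UnitAddTorus d → EuclideanSpace ℝ d) (x : UnitAddTorus d) :
    FunctionSpaces.Torus.convect u (0 : UnitAddTorus d → F) x = 0 := by
  simp only [FunctionSpaces.Torus.convect, FunctionSpaces.Torus.fderiv]
  rw [show FunctionSpaces.Torus.liftAt (0 : UnitAddTorus d → F) x = fun _ => 0 from rfl]
  simp


/-! ## Space–time test fields: products with time cutoffs, translates, slice calculus -/

section TestFields

variable {F : Type*} [NormedAddCommGroup F] [NormedSpace ℝ F]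

omit [Fintype d] [DecidableEq d] [NormedSpace ℝ F] in
/-- A field continuous on `S × T^d` has a space–time lift continuous on `S × ℝ^d`. [folklore] -/
theorem continuousOn_stLift_of_continuousOn_uncurry {S : Set ℝ} {v : ℝ → UnitAddTorus d → F}
    (hv : ContinuousOn (uncurry v) (S ×ˢ univ)) :
    ContinuousOn (FunctionSpaces.Torus.stLift v) (S ×ˢ univ) := by
  have h : FunctionSpaces.Torus.stLift v = uncurry v ∘ Prod.map id FunctionSpaces.Torus.proj := by
    funext p
    rfl
  rw [h]
  exact hv.comp (continuous_id.prodMap FunctionSpaces.Torus.continuous_proj).continuousOn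
    fun p hp => ⟨(mem_prod.1 hp).1, mem_univ _⟩

omit [Fintype d] [DecidableEq d] [NormedSpace ℝ F] in
/-- Slices `v t`, `t ∈ S`, of a field continuous on `S × T^d` are continuous. [folklore] -/
theorem continuous_slice_of_continuousOn_uncurry {S : Set ℝ} {v : ℝ → UnitAddTorus d → F}
    (hv : ContinuousOn (uncurry v) (S ×ˢ univ)) {t : ℝ} (ht : t ∈ S) : Continuous (v t) :=
  hv.comp_continuous (f := fun x : UnitAddTorus d => (t, x)) (continuous_const.prodMk continuous_id)
    fun x => ⟨ht, mem_univ x⟩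

omit [DecidableEq d] in
/-- **Products with a time cutoff are admissible tests on the open interval.** If `η ∈ C^∞(ℝ)`
vanishes on `(-∞, ε]` (`ε > 0`) and on `[T', ∞)` (`T' < T`), and `ψ` is smooth on `ℝ × T^d`, then
`(t, x) ↦ η(t) ψ(t, x)` is a space–time test field compactly supported in `(0, T)`. [folklore] -/
theorem isSpaceTimeTestIoo_smul {T ε T' : ℝ} {η : ℝ → ℝ} (hη : ContDiff ℝ ∞ η) (hε : 0 < ε)
    (hT' : T' < T) (h0 : ∀ t ≤ ε, η t = 0) (h1 : ∀ t, T' ≤ t → η t = 0)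
    {ψ : ℝ → UnitAddTorus d → F} (hψ : ContDiff ℝ ∞ (FunctionSpaces.Torus.stLift ψ)) :
    FunctionSpaces.Torus.IsSpaceTimeTestIoo T (fun t x => η t • ψ t x) := by
  refine ⟨⟨?_, T', hT', fun t ht => ?_⟩, ε, hε, fun t ht => ?_⟩
  · have h : FunctionSpaces.Torus.stLift (fun t x => η t • ψ t x) =
        fun p : ℝ × EuclideanSpace ℝ d => η p.1 • FunctionSpaces.Torus.stLift ψ p := by
      funext p
      rfl
    rw [h]
    exact (hη.comp contDiff_fst).smul hψ
  · funext x
    simp [h1 t ht]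
  · funext x
    simp [h0 t ht]

/-- Products `η(t) ψ(t, x)` with a divergence-free `ψ` are divergence free. [folklore] -/
theorem isDivFreeTest_smul' (η : ℝ → ℝ) {ψ : ℝ → UnitAddTorus d → EuclideanSpace ℝ d}
    (hψ : FunctionSpaces.Torus.IsDivFreeTest ψ) :
    FunctionSpaces.Torus.IsDivFreeTest (fun t x => η t • ψ t x) := fun t x => by
  change FunctionSpaces.Torus.divergence (fun y => η t • ψ t y) x = 0
  rw [divergence_fun_const_smul, hψ t x, mul_zero]

omit [DecidableEq d] in
/-- Time slices of a smooth space–time field are differentiable in time at a fixed point. [folklore] -/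
theorem differentiable_apply_of_contDiff_stLift {ψ : ℝ → UnitAddTorus d → F}
    (hψ : ContDiff ℝ ∞ (FunctionSpaces.Torus.stLift ψ)) (x : UnitAddTorus d) :
    Differentiable ℝ fun t => ψ t x := by
  obtain ⟨y, rfl⟩ := FunctionSpaces.Torus.proj_surjective x
  have h : (fun t => ψ t (FunctionSpaces.Torus.proj y)) = FunctionSpaces.Torus.stLift ψ ∘ fun t => (t, y) := by
    funext t
    rfl
  rw [h]
  exact (hψ.differentiable (by simp)).comp (differentiable_id.prodMk (differentiable_const y))

omit [DecidableEq d] in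
/-- Time derivative of a product field: `∂ₜ(η ψ)(t, x) = η'(t) ψ(t, x) + η(t) ∂ₜψ(t, x)`. [folklore] -/
theorem timeDeriv_smul' {η : ℝ → ℝ} (hη : Differentiable ℝ η) {ψ : ℝ → UnitAddTorus d → F}
    (hψ : ContDiff ℝ ∞ (FunctionSpaces.Torus.stLift ψ)) (t : ℝ) (x : UnitAddTorus d) :
    FunctionSpaces.Torus.timeDeriv (fun s y => η s • ψ s y) t x =
      deriv η t • ψ t x + η t • FunctionSpaces.Torus.timeDeriv ψ t x := by
  simp only [FunctionSpaces.Torus.timeDeriv]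
  have h := ((hη t).hasDerivAt.smul ((differentiable_apply_of_contDiff_stLift hψ x) t).hasDerivAt).deriv
  rw [add_comm] at h
  exact h

omit [DecidableEq d] in
/-- A space–time test field on `[0, S)` is one on `[0, S')` for every `S' ≥ S`. [folklore] -/
theorem _root_.Literature.Analysis.FunctionSpaces.Torus.IsSpaceTimeTest.of_le {S S' : ℝ}
    {ψ : ℝ → UnitAddTorus d → F} (hψ : FunctionSpaces.Torus.IsSpaceTimeTest S ψ) (hS : S ≤ S') :
    FunctionSpaces.Torus.IsSpaceTimeTest S' ψ := by
  obtain ⟨hs, T', hT', h⟩ := hψ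
  exact ⟨hs, T', hT'.trans_le hS, h⟩

omit [DecidableEq d] in
/-- **Time translates of test fields**: if `ψ` is a test field on `[0, S)` then `ψ(· + T)` is a
test field on `[0, S - T)`. [folklore] -/
theorem _root_.Literature.Analysis.FunctionSpaces.Torus.IsSpaceTimeTest.comp_add_right {S : ℝ}
    {ψ : ℝ → UnitAddTorus d → F} (hψ : FunctionSpaces.Torus.IsSpaceTimeTest S ψ) (T : ℝ) :
    FunctionSpaces.Torus.IsSpaceTimeTest (S - T) (fun t => ψ (t + T)) := by
  obtain ⟨hs, S', hS', h⟩ := hψ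
  refine ⟨?_, S' - T, by linarith, fun t ht => h (t + T) (by linarith)⟩
  rw [stLift_comp_add_right]
  exact hs.comp (contDiff_prodMap_add_right T)

end TestFields

/-! ## The weak-form integrand of the fractional system against a test field -/

section WeakIntegrand

variable {α ν : ℝ} {ψ : ℝ → UnitAddTorus d → EuclideanSpace ℝ d} {S₀ : ℝ}

/-- On a slice: for a continuous `U` and a test field `ψ`, the weak-form integrand
`⟪U, ∂ₜψ(t)⟫ + ⟪U, (U·∇)ψ(t)⟫ - ν⟪U, (-Δ)^α ψ(t)⟫` is continuous on the torus (`α ≥ 0`). [folklore] -/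
theorem continuous_fracWeakIntegrand_slice (hα : 0 ≤ α) (hψ : FunctionSpaces.Torus.IsSpaceTimeTest S₀ ψ)
    {U : UnitAddTorus d → EuclideanSpace ℝ d} (hU : Continuous U) (t : ℝ) :
    Continuous fun x => ⟪U x, FunctionSpaces.Torus.timeDeriv ψ t x⟫_ℝ +
      ⟪U x, FunctionSpaces.Torus.convect U (ψ t) x⟫_ℝ - ν * ⟪U x, fracLaplacian α (ψ t) x⟫_ℝ := by
  have hp : Continuous (FunctionSpaces.Torus.timeDeriv ψ t) := (hψ.timeDeriv.isSmooth_slice t).continuous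
  have hconv : Continuous fun x => FunctionSpaces.Torus.convect U (ψ t) x := by
    have h : (fun x => FunctionSpaces.Torus.convect U (ψ t) x) =
        fun x => ∑ i, (U x) i • FunctionSpaces.Torus.partialDeriv i (ψ t) x := by
      funext x
      exact FunctionSpaces.Torus.fderiv_apply_eq_sum_partialDeriv ((hψ.isSmooth_slice t).isContDiff (by simp)) _ _
    rw [h]
    exact continuous_finsetSum _ fun i _ =>
      ((EuclideanSpace.proj (𝕜 := ℝ) i).continuous.comp hU).smul ((hψ.isSmooth_slice t).partialDeriv i).continuous
  have hL : Continuous (fracLaplacian α (ψ t)) := continuous_fracLaplacian hα (hψ.isSmooth_slice t)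
  exact ((hU.inner hp).add (hU.inner hconv)).sub (continuous_const.mul (hU.inner hL))

omit [DecidableEq d] in
/-- The pairing `t ↦ ∫ ⟪v t, ψ t⟫` is continuous on `S` when `v` has a space–time lift continuous
on `S × ℝ^d` and `ψ` is a test field. [folklore] -/
theorem continuousOn_integral_inner_test {S : Set ℝ} {v : ℝ → UnitAddTorus d → EuclideanSpace ℝ d}
    (hv : ContinuousOn (FunctionSpaces.Torus.stLift v) (S ×ˢ univ)) (hψ : FunctionSpaces.Torus.IsSpaceTimeTest S₀ ψ) :
    ContinuousOn (fun t => ∫ x, ⟪v t x, ψ t x⟫_ℝ) S :=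
  FunctionSpaces.Torus.continuousOn_integral_of_continuousOn_stLift
    (u := fun t x => ⟪v t x, ψ t x⟫_ℝ) (hv.inner hψ.1.continuous.continuousOn)

/-- **Continuity in time of the weak-form functional**
`t ↦ ∫ (⟪v t, ∂ₜψ t⟫ + ⟪v t, (v t·∇)ψ t⟫ - ν⟪v t, (-Δ)^α ψ t⟫)` on `S`, for `v` with space–time lift
continuous on `S × ℝ^d` and a test field `ψ` (all integrands are jointly continuous;
`Torus.continuous_stLift_fracLaplacian` for the dissipative term). [folklore] -/
theorem continuousOn_fracWeakFunctional (hα : 0 ≤ α) {S : Set ℝ}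
    {v : ℝ → UnitAddTorus d → EuclideanSpace ℝ d}
    (hv : ContinuousOn (FunctionSpaces.Torus.stLift v) (S ×ˢ univ)) (hψ : FunctionSpaces.Torus.IsSpaceTimeTest S₀ ψ) :
    ContinuousOn (fun t => ∫ x, (⟪v t x, FunctionSpaces.Torus.timeDeriv ψ t x⟫_ℝ +
      ⟪v t x, FunctionSpaces.Torus.convect (v t) (ψ t) x⟫_ℝ - ν * ⟪v t x, fracLaplacian α (ψ t) x⟫_ℝ)) S := by
  refine FunctionSpaces.Torus.continuousOn_integral_of_continuousOn_stLift ?_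
  have hp : Continuous (FunctionSpaces.Torus.stLift (FunctionSpaces.Torus.timeDeriv ψ)) := hψ.timeDeriv.1.continuous
  have hD : ∀ i, Continuous (FunctionSpaces.Torus.stLift fun t => FunctionSpaces.Torus.partialDeriv i (ψ t)) :=
    fun i => (hψ.isSmoothSpaceTimeOn_partialDeriv i).continuous_stLift_of_univ
  have hL : Continuous (FunctionSpaces.Torus.stLift fun t => fracLaplacian α (ψ t)) :=
    continuous_stLift_fracLaplacian hα (hψ.isSmoothSpaceTimeOn univ)
  have h : (FunctionSpaces.Torus.stLift fun t x => ⟪v t x, FunctionSpaces.Torus.timeDeriv ψ t x⟫_ℝ +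
      ⟪v t x, FunctionSpaces.Torus.convect (v t) (ψ t) x⟫_ℝ - ν * ⟪v t x, fracLaplacian α (ψ t) x⟫_ℝ) =
      fun q => ⟪FunctionSpaces.Torus.stLift v q, FunctionSpaces.Torus.stLift (FunctionSpaces.Torus.timeDeriv ψ) q⟫_ℝ +
        ⟪FunctionSpaces.Torus.stLift v q, ∑ i, (FunctionSpaces.Torus.stLift v q) i •
          FunctionSpaces.Torus.stLift (fun t => FunctionSpaces.Torus.partialDeriv i (ψ t)) q⟫_ℝ -
        ν * ⟪FunctionSpaces.Torus.stLift v q, FunctionSpaces.Torus.stLift (fun t => fracLaplacian α (ψ t)) q⟫_ℝ := by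
    funext q
    obtain ⟨t, y⟩ := q
    simp only [FunctionSpaces.Torus.stLift_apply, FunctionSpaces.Torus.convect]
    rw [FunctionSpaces.Torus.fderiv_apply_eq_sum_partialDeriv ((hψ.isSmooth_slice t).isContDiff (by simp))]
  rw [h]
  exact ((hv.inner hp.continuousOn).add (hv.inner (continuousOn_finsetSum _ fun i _ =>
    ((EuclideanSpace.proj (𝕜 := ℝ) i).continuous.comp_continuousOn hv).smul (hD i).continuousOn))).sub
    (continuousOn_const.mul (hv.inner hL.continuousOn))

end WeakIntegrand


/-! ## The end-point form of the weak identity for continuous local solutions -/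

section Endpoint

variable {T α ν S₀ : ℝ} {v : ℝ → UnitAddTorus d → EuclideanSpace ℝ d}
  {ψ : ℝ → UnitAddTorus d → EuclideanSpace ℝ d}

/-- **The interior weak identity tested with a product `η(t) ψ(t, x)`.** Let `v` be a
distributional solution of the fractional system on `T^d × (0, T)` (`Torus.IsWeakFracNSSolutionOn`)
which is continuous on the closed slab `[0, T] × T^d`, let `ψ` be a smooth divergence-free
space–time field and `η ∈ C^∞(ℝ)` a cutoff vanishing on `(-∞, ε]` and on `[T', ∞)` with
`0 < ε`, `T' < T`. Then, with `P(t) = ∫ ⟪v(t), ψ(t)⟫` and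
`Φ(t) = ∫ (⟪v, ∂ₜψ⟫ + ⟪v, (v·∇)ψ⟫ - ν⟪v, (-Δ)^α ψ⟫)(t)`,
`∫_{(0,T)} (η' P + η Φ) = 0` (product rule in time, linearity of `(u·∇)` and `(-Δ)^α` in the
test field). [folklore] -/
theorem IsWeakFracNSSolutionOn.test_smul (hw : IsWeakFracNSSolutionOn T α ν v) (hα : 0 ≤ α)
    (hc : ContinuousOn (uncurry v) (Icc 0 T ×ˢ univ))
    (hψ : FunctionSpaces.Torus.IsSpaceTimeTest S₀ ψ) (hdiv : FunctionSpaces.Torus.IsDivFreeTest ψ)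
    {η : ℝ → ℝ} (hη : ContDiff ℝ ∞ η) {ε T' : ℝ} (hε : 0 < ε) (hT' : T' < T)
    (h0 : ∀ t ≤ ε, η t = 0) (h1 : ∀ t, T' ≤ t → η t = 0) :
    ∫ t in Ioo 0 T, (deriv η t * (∫ x, ⟪v t x, ψ t x⟫_ℝ) + η t *
      ∫ x, (⟪v t x, FunctionSpaces.Torus.timeDeriv ψ t x⟫_ℝ +
        ⟪v t x, FunctionSpaces.Torus.convect (v t) (ψ t) x⟫_ℝ - ν * ⟪v t x, fracLaplacian α (ψ t) x⟫_ℝ)) = 0 := by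
  have hid := hw.2.2.2 (fun t x => η t • ψ t x) (isSpaceTimeTestIoo_smul hη hε hT' h0 h1 hψ.1)
    (isDivFreeTest_smul' η hdiv)
  refine Eq.trans (setIntegral_congr_fun measurableSet_Ioo fun t ht => Eq.symm ?_) hid
  have htI : t ∈ Icc 0 T := Ioo_subset_Icc_self ht
  have hvt : Continuous (v t) := continuous_slice_of_continuousOn_uncurry hc htI
  have hpt : ∀ x, ⟪v t x, FunctionSpaces.Torus.timeDeriv (fun s y => η s • ψ s y) t x⟫_ℝ +
      ⟪v t x, FunctionSpaces.Torus.convect (v t) (fun y => η t • ψ t y) x⟫_ℝ -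
        ν * ⟪v t x, fracLaplacian α (fun y => η t • ψ t y) x⟫_ℝ =
      deriv η t * ⟪v t x, ψ t x⟫_ℝ + η t * (⟪v t x, FunctionSpaces.Torus.timeDeriv ψ t x⟫_ℝ +
        ⟪v t x, FunctionSpaces.Torus.convect (v t) (ψ t) x⟫_ℝ - ν * ⟪v t x, fracLaplacian α (ψ t) x⟫_ℝ) := by
    intro x
    rw [timeDeriv_smul' (hη.differentiable (by simp)) hψ.1,
      convect_const_smul (v t) ((hψ.isSmooth_slice t).isContDiff (by simp)) (η t) x,
      fracLaplacian_fun_const_smul]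
    simp only [inner_add_right, real_inner_smul_right]
    ring
  have i1 : Integrable (fun x => ⟪v t x, ψ t x⟫_ℝ) volume :=
    (hvt.inner (hψ.isSmooth_slice t).continuous).integrable_unitAddTorus
  have i2 : Integrable (fun x => ⟪v t x, FunctionSpaces.Torus.timeDeriv ψ t x⟫_ℝ +
      ⟪v t x, FunctionSpaces.Torus.convect (v t) (ψ t) x⟫_ℝ - ν * ⟪v t x, fracLaplacian α (ψ t) x⟫_ℝ) volume :=
    (continuous_fracWeakIntegrand_slice hα hψ hvt t).integrable_unitAddTorus
  calc ∫ x, (⟪v t x, FunctionSpaces.Torus.timeDeriv (fun s y => η s • ψ s y) t x⟫_ℝ +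
        ⟪v t x, FunctionSpaces.Torus.convect (v t) (fun y => η t • ψ t y) x⟫_ℝ -
          ν * ⟪v t x, fracLaplacian α (fun y => η t • ψ t y) x⟫_ℝ)
      = ∫ x, (deriv η t * ⟪v t x, ψ t x⟫_ℝ + η t * (⟪v t x, FunctionSpaces.Torus.timeDeriv ψ t x⟫_ℝ +
          ⟪v t x, FunctionSpaces.Torus.convect (v t) (ψ t) x⟫_ℝ - ν * ⟪v t x, fracLaplacian α (ψ t) x⟫_ℝ)) :=
        integral_congr_ae (ae_of_all _ hpt)
    _ = _ := by
        rw [integral_add (i1.const_mul _) (i2.const_mul _), integral_const_mul, integral_const_mul]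

omit [Fintype d] [DecidableEq d] in
/-- A smooth step: for `a < b` there is `θ ∈ C^∞(ℝ)` with `θ = 0` on `(-∞, a]` and `θ = 1` on
`[b, ∞)` (Mathlib's `Real.smoothTransition`, rescaled). [folklore] -/
theorem exists_smooth_step {a b : ℝ} (hab : a < b) :
    ∃ θ : ℝ → ℝ, ContDiff ℝ ∞ θ ∧ (∀ t ≤ a, θ t = 0) ∧ ∀ t, b ≤ t → θ t = 1 := by
  refine ⟨fun t => Real.smoothTransition ((t - a) / (b - a)), ?_, fun t ht => ?_, fun t ht => ?_⟩
  · exact Real.smoothTransition.contDiff.comp ((contDiff_id.sub contDiff_const).div_const _)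
  · exact Real.smoothTransition.zero_of_nonpos
      (div_nonpos_of_nonpos_of_nonneg (by linarith) (by linarith))
  · exact Real.smoothTransition.one_of_one_le ((one_le_div (by linarith)).2 (by linarith))

/-- **End-point form of the weak identity for continuous distributional solutions.** Let `v` be
a distributional solution of the fractional system on `T^d × (0, T)`, `T > 0`, `α ≥ 0`
(`Torus.IsWeakFracNSSolutionOn T α ν v`: tests compactly supported in `(0, T)`), continuous on the
closed slab `[0, T] × T^d`. Then for every smooth divergence-free space–time field `ψ` (a test
field on some `[0, S₀)`, no support condition inside `[0, T]`),
`∫_{(0,T]} ∫ (⟪v, ∂ₜψ⟫ + ⟪v, (v·∇)ψ⟫ - ν⟪v, (-Δ)^α ψ⟫) = ∫⟪v(T), ψ(T)⟫ - ∫⟪v(0), ψ(0)⟫`.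
Proof: with `P(t) = ∫⟪v(t), ψ(t)⟫`, `Φ` the flux and `θ` a smooth step from `0` to `1` inside
`(0, b]`, testing with `η θ ψ` (`IsWeakFracNSSolutionOn.test_smul`) shows that `U = θP`,
`F = θ'P + θΦ`, `c = 0` satisfy the hypothesis of the du Bois-Reymond lemma
`Literature.Analysis.FunctionSpaces.eq_add_setIntegral_of_forall_test`; hence `P - ∫₀Φ` is
constant on `[b, T)` for every `b ∈ (0, T)`, so constant on `(0, T)`, and by continuity on
`[0, T]`. (Colombo–De Lellis–De Rosa 2018, §1: the step implicit in "can be prolonged past the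
time `T`"; Temam 1984, Ch. III §1.1, (1.22)–(1.25); Galdi 2000, Lemma 2.1.) [folklore] -/
theorem IsWeakFracNSSolutionOn.setIntegral_Ioc_eq_sub (hw : IsWeakFracNSSolutionOn T α ν v)
    (hT : 0 < T) (hα : 0 ≤ α) (hc : ContinuousOn (uncurry v) (Icc 0 T ×ˢ univ))
    (hψ : FunctionSpaces.Torus.IsSpaceTimeTest S₀ ψ) (hdiv : FunctionSpaces.Torus.IsDivFreeTest ψ) :
    ∫ t in Ioc 0 T, ∫ x, (⟪v t x, FunctionSpaces.Torus.timeDeriv ψ t x⟫_ℝ +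
        ⟪v t x, FunctionSpaces.Torus.convect (v t) (ψ t) x⟫_ℝ - ν * ⟪v t x, fracLaplacian α (ψ t) x⟫_ℝ) =
      (∫ x, ⟪v T x, ψ T x⟫_ℝ) - ∫ x, ⟪v 0 x, ψ 0 x⟫_ℝ := by
  set P : ℝ → ℝ := fun t => ∫ x, ⟪v t x, ψ t x⟫_ℝ with hP
  set Φ : ℝ → ℝ := fun t => ∫ x, (⟪v t x, FunctionSpaces.Torus.timeDeriv ψ t x⟫_ℝ +
    ⟪v t x, FunctionSpaces.Torus.convect (v t) (ψ t) x⟫_ℝ - ν * ⟪v t x, fracLaplacian α (ψ t) x⟫_ℝ) with hΦ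
  have hv' := continuousOn_stLift_of_continuousOn_uncurry hc
  have hPc : ContinuousOn P (Icc 0 T) := continuousOn_integral_inner_test hv' hψ
  have hΦc : ContinuousOn Φ (Icc 0 T) := continuousOn_fracWeakFunctional hα hv' hψ
  have hΦi : IntegrableOn Φ (Icc 0 T) := hΦc.integrableOn_Icc
  have hΦii : ∀ {a b : ℝ}, a ∈ Icc 0 T → b ∈ Icc 0 T → IntervalIntegrable Φ volume a b :=
    fun ha hb => (hΦi.mono_set (uIcc_subset_Icc ha hb)).intervalIntegrable
  -- the primitive `Q t = ∫₀ᵗ Φ`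
  set Q : ℝ → ℝ := fun t => ∫ s in (0 : ℝ)..t, Φ s with hQ
  have hQc : ContinuousOn Q (Icc 0 T) := by
    have h := intervalIntegral.continuousOn_primitive_interval (μ := volume) (f := Φ) (a := 0) (b := T)
      (by rwa [uIcc_of_le hT.le])
    rwa [uIcc_of_le hT.le] at h
  -- `P - Q` is constant on `[b, T)` for every `b ∈ (0, T)`
  have key : ∀ b, 0 < b → b < T → ∀ t ∈ Ico b T, P t - Q t = P b - Q b := by
    intro b hb hbT t ht
    obtain ⟨θ, hθ, hθ0, hθ1⟩ := exists_smooth_step (half_lt_self hb)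
    have hθd : Differentiable ℝ θ := hθ.differentiable (by simp)
    have hθ'c : Continuous (deriv θ) := hθ.continuous_deriv (by simp)
    have hθc : Continuous θ := hθ.continuous
    have hU : IntegrableOn (fun t => θ t * P t) (Ioo 0 T) :=
      ((hθc.continuousOn.mul hPc).integrableOn_Icc).mono_set Ioo_subset_Icc_self
    have hGc : ContinuousOn (fun t => deriv θ t * P t + θ t * Φ t) (Icc 0 T) :=
      (hθ'c.continuousOn.mul hPc).add (hθc.continuousOn.mul hΦc)
    have hG : IntegrableOn (fun t => deriv θ t * P t + θ t * Φ t) (Icc 0 T) := hGc.integrableOn_Icc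
    have hUc : ContinuousOn (fun t => θ t * P t) (Ioo 0 T) :=
      (hθc.continuousOn.mul hPc).mono Ioo_subset_Icc_self
    -- the hypothesis of the du Bois-Reymond lemma, from the weak identity tested with `η θ ψ`
    have hhyp : ∀ η : ℝ → ℝ, ContDiff ℝ ∞ η → HasCompactSupport η → tsupport η ⊆ Iio T →
        (∫ s in Ioo 0 T, (deriv η s * (θ s * P s) + η s * (deriv θ s * P s + θ s * Φ s))) +
          η 0 * 0 = 0 := by
      intro η hη hηc hηT
      obtain ⟨T', hT'T, hT'⟩ := FunctionSpaces.exists_lt_forall_eq_zero_of_tsupport_subset_Iio hηc hηT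
      have h := hw.test_smul hα hc hψ hdiv (hη.mul hθ) (half_pos hb) hT'T
        (fun s hs => by simp [hθ0 s hs]) (fun s hs => by simp [hT' s hs])
      rw [mul_zero, add_zero]
      refine Eq.trans (setIntegral_congr_fun measurableSet_Ioo fun s _ => ?_) h
      rw [deriv_fun_mul (hη.differentiable (by simp) s) (hθd s)]
      ring
    have hDBR : ∀ {t : ℝ}, t ∈ Ioo 0 T → θ t * P t = 0 + ∫ s in Ioc 0 t, (deriv θ s * P s + θ s * Φ s) :=
      fun ht => FunctionSpaces.eq_add_setIntegral_of_forall_test (c := 0) hU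
        (hG.mono_set Ioo_subset_Icc_self) hUc hhyp ht
    -- evaluate the du Bois-Reymond identity at `t` and at `b`
    have hbI : b ∈ Ioo 0 T := ⟨hb, hbT⟩
    have htI : t ∈ Ioo 0 T := ⟨hb.trans_le ht.1, ht.2⟩
    have h1 := hDBR htI
    have h2 := hDBR hbI
    rw [hθ1 t ht.1, one_mul, zero_add, ← intervalIntegral.integral_of_le htI.1.le] at h1
    rw [hθ1 b le_rfl, one_mul, zero_add, ← intervalIntegral.integral_of_le hb.le] at h2
    have hGii : ∀ {a c : ℝ}, a ∈ Icc 0 T → c ∈ Icc 0 T →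
        IntervalIntegrable (fun t => deriv θ t * P t + θ t * Φ t) volume a c :=
      fun ha hc' => (hG.mono_set (uIcc_subset_Icc ha hc')).intervalIntegrable
    have h0I : (0 : ℝ) ∈ Icc 0 T := ⟨le_rfl, hT.le⟩
    have htI' : t ∈ Icc 0 T := Ioo_subset_Icc_self htI
    have hbI' : b ∈ Icc 0 T := Ioo_subset_Icc_self hbI
    -- `P t - P b = ∫_b^t G = ∫_b^t Φ = Q t - Q b`
    have h3 : P t - P b = ∫ s in b..t, (deriv θ s * P s + θ s * Φ s) := by
      rw [h1, h2, intervalIntegral.integral_interval_sub_left (hGii h0I htI') (hGii h0I hbI')]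
    have h4 : ∫ s in b..t, (deriv θ s * P s + θ s * Φ s) = ∫ s in b..t, Φ s := by
      rw [intervalIntegral.integral_of_le ht.1, intervalIntegral.integral_of_le ht.1]
      refine setIntegral_congr_fun measurableSet_Ioc fun s hs => ?_
      have hev : θ =ᶠ[𝓝 s] fun _ => (1 : ℝ) := by
        filter_upwards [Ioi_mem_nhds hs.1] with r hr using hθ1 r (le_of_lt hr)
      rw [hev.deriv_eq, deriv_const, hθ1 s hs.1.le]
      ring
    have h5 : Q t - Q b = ∫ s in b..t, Φ s := by
      simp only [hQ]
      rw [intervalIntegral.integral_interval_sub_left (hΦii h0I htI') (hΦii h0I hbI')]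
    linarith
  -- hence `P - Q` is constant on `(0, T)`, and by continuity on `[0, T]`
  have hconst : EqOn (fun t => P t - Q t) (fun _ => P (T / 2) - Q (T / 2)) (Icc 0 T) := by
    refine Set.EqOn.of_subset_closure ?_ (hPc.sub hQc) continuousOn_const Ioo_subset_Icc_self ?_
    · intro t ht
      rcases le_total t (T / 2) with h | h
      · exact (key t ht.1 ht.2 (T / 2) ⟨h, by linarith⟩).symm
      · exact key (T / 2) (by linarith) (by linarith) t ⟨h, ht.2⟩
    · rw [closure_Ioo hT.ne]
  have hT' := hconst ⟨hT.le, le_rfl⟩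
  have h0' := hconst ⟨le_rfl, hT.le⟩
  simp only at hT' h0'
  have hQ0 : Q 0 = 0 := intervalIntegral.integral_same
  have hQT : Q T = ∫ t in Ioc 0 T, Φ t := intervalIntegral.integral_of_le hT.le
  rw [← hQT]
  linarith

end Endpoint


/-! ## The weak-form functional of a field in the Leray class: measurability, integrability -/

section LerayClass

variable {α ν S₀ : ℝ} {w : ℝ → UnitAddTorus d → EuclideanSpace ℝ d}
  {ψ : ℝ → UnitAddTorus d → EuclideanSpace ℝ d}

omit [DecidableEq d] in
/-- Joint measurability on `(0, ∞) × T^d` (product of the restricted Lebesgue measure and the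
volume of the torus) from measurability of the space–time lift on `(0, ∞) × ℝ^d`. [folklore] -/
theorem aestronglyMeasurable_uncurry_Ioi
    (hm : AEStronglyMeasurable (FunctionSpaces.Torus.stLift w) (volume.restrict (Ioi 0 ×ˢ univ))) :
    AEStronglyMeasurable (uncurry w) ((volume.restrict (Ioi 0)).prod volume) := by
  have h := FunctionSpaces.Torus.aestronglyMeasurable_uncurry_of_stLift_restrict hm
  rwa [Measure.volume_eq_prod, ← Measure.prod_restrict, Measure.restrict_univ] at h

/-- **Time-measurability of the weak-form functional** of a space–time measurable field against
a test field, on `(0, ∞)` (Fubini). [folklore] -/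
theorem aestronglyMeasurable_fracWeakFunctional (hα : 0 ≤ α)
    (hm : AEStronglyMeasurable (FunctionSpaces.Torus.stLift w) (volume.restrict (Ioi 0 ×ˢ univ)))
    (hψ : FunctionSpaces.Torus.IsSpaceTimeTest S₀ ψ) :
    AEStronglyMeasurable (fun t => ∫ x, (⟪w t x, FunctionSpaces.Torus.timeDeriv ψ t x⟫_ℝ +
      ⟪w t x, FunctionSpaces.Torus.convect (w t) (ψ t) x⟫_ℝ - ν * ⟪w t x, fracLaplacian α (ψ t) x⟫_ℝ))
      (volume.restrict (Ioi 0)) := by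
  have hu' := aestronglyMeasurable_uncurry_Ioi hm
  have hp : Continuous (uncurry (FunctionSpaces.Torus.timeDeriv ψ)) :=
    FunctionSpaces.Torus.continuous_uncurry_of_continuous_stLift hψ.timeDeriv.1.continuous
  have hL : Continuous (uncurry fun t => fracLaplacian α (ψ t)) :=
    FunctionSpaces.Torus.continuous_uncurry_of_continuous_stLift
      (continuous_stLift_fracLaplacian hα (hψ.isSmoothSpaceTimeOn univ))
  have hD : ∀ i, Continuous (uncurry fun t => FunctionSpaces.Torus.partialDeriv i (ψ t)) := fun i =>
    FunctionSpaces.Torus.continuous_uncurry_of_continuous_stLift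
      (hψ.isSmoothSpaceTimeOn_partialDeriv i).continuous_stLift_of_univ
  have h : AEStronglyMeasurable (fun q : ℝ × UnitAddTorus d =>
      ⟪uncurry w q, uncurry (FunctionSpaces.Torus.timeDeriv ψ) q⟫_ℝ +
      ⟪uncurry w q, ∑ i, (uncurry w q) i • uncurry (fun t => FunctionSpaces.Torus.partialDeriv i (ψ t)) q⟫_ℝ -
      ν * ⟪uncurry w q, uncurry (fun t => fracLaplacian α (ψ t)) q⟫_ℝ)
      ((volume.restrict (Ioi 0)).prod volume) :=
    ((hu'.inner hp.aestronglyMeasurable).add (hu'.inner (Finset.aestronglyMeasurable_fun_sum _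
      fun i _ => ((EuclideanSpace.proj (𝕜 := ℝ) i).continuous.comp_aestronglyMeasurable hu').smul
        (hD i).aestronglyMeasurable))).sub ((hu'.inner hL.aestronglyMeasurable).const_mul ν)
  refine h.integral_prod_right'.congr (ae_of_all _ fun t => ?_)
  refine integral_congr_ae (ae_of_all _ fun x => ?_)
  simp only [uncurry_apply_pair, FunctionSpaces.Torus.convect]
  rw [FunctionSpaces.Torus.fderiv_apply_eq_sum_partialDeriv ((hψ.isSmooth_slice t).isContDiff (by simp))]

/-- **Slice estimate for the weak-form functional**: for `U ∈ L²(T^d)`, a smooth `b` with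
`∑ᵢ ‖∂ᵢ b‖ ≤ C`, and continuous `p`, `L` with `‖p‖ ≤ K_p`, `‖L‖ ≤ K_L`,
`|∫ (⟪U, p⟫ + ⟪U, (U·∇)b⟫ - ν⟪U, L⟫)| ≤ (K_p + |ν| K_L) · ½(1 + ∫‖U‖²) + C ∫‖U‖²`. [folklore] -/
theorem abs_fracWeakFunctional_slice_le {U b p L : UnitAddTorus d → EuclideanSpace ℝ d}
    (hU : MemLp U 2 volume) (hb : FunctionSpaces.Torus.IsSmooth b) (hp : Continuous p) (hL : Continuous L)
    {C Kp KL : ℝ} (hC : ∀ x, ∑ i, ‖FunctionSpaces.Torus.partialDeriv i b x‖ ≤ C)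
    (hKp : ∀ x, ‖p x‖ ≤ Kp) (hKL : ∀ x, ‖L x‖ ≤ KL) (ν : ℝ) :
    |∫ x, (⟪U x, p x⟫_ℝ + ⟪U x, FunctionSpaces.Torus.convect U b x⟫_ℝ - ν * ⟪U x, L x⟫_ℝ)| ≤
      (Kp + |ν| * KL) * (2⁻¹ * (1 + ∫ x, ‖U x‖ ^ 2)) + C * ∫ x, ‖U x‖ ^ 2 := by
  have i1 : Integrable (fun x => ⟪U x, p x⟫_ℝ) volume :=
    FunctionSpaces.Torus.integrable_inner_of_continuous (hU.integrable one_le_two) hp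
  have i2 : Integrable (fun x => ⟪U x, FunctionSpaces.Torus.convect U b x⟫_ℝ) volume :=
    integrable_inner_convect_self hU hb
  have i3 : Integrable (fun x => ⟪U x, L x⟫_ℝ) volume :=
    FunctionSpaces.Torus.integrable_inner_of_continuous (hU.integrable one_le_two) hL
  have i12 : Integrable (fun x => ⟪U x, p x⟫_ℝ + ⟪U x, FunctionSpaces.Torus.convect U b x⟫_ℝ) volume :=
    i1.add i2
  have i3' : Integrable (fun x => ν * ⟪U x, L x⟫_ℝ) volume := i3.const_mul ν
  rw [integral_sub i12 i3', integral_add i1 i2, integral_const_mul]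
  have b1 := abs_integral_inner_le_of_norm_le (hU.integrable one_le_two) hKp
  have b2 := abs_integral_inner_convect_self_le hU hb hC
  have b3 := abs_integral_inner_le_of_norm_le (hU.integrable one_le_two) hKL
  have b4 := integral_norm_le_of_memLp_two hU
  have hKp0 : 0 ≤ Kp := (norm_nonneg _).trans (hKp 0)
  have hKL0 : 0 ≤ KL := (norm_nonneg _).trans (hKL 0)
  have hI1 : 0 ≤ ∫ x, ‖U x‖ := integral_nonneg fun x => norm_nonneg _
  have htri : |(∫ x, ⟪U x, p x⟫_ℝ) + (∫ x, ⟪U x, FunctionSpaces.Torus.convect U b x⟫_ℝ) -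
      ν * ∫ x, ⟪U x, L x⟫_ℝ| ≤ |∫ x, ⟪U x, p x⟫_ℝ| + |∫ x, ⟪U x, FunctionSpaces.Torus.convect U b x⟫_ℝ| +
      |ν| * |∫ x, ⟪U x, L x⟫_ℝ| := by
    rw [← abs_mul]
    exact (abs_sub _ _).trans (add_le_add (abs_add_le _ _) le_rfl)
  have h5 : |ν| * |∫ x, ⟪U x, L x⟫_ℝ| ≤ |ν| * (KL * ∫ x, ‖U x‖) :=
    mul_le_mul_of_nonneg_left b3 (abs_nonneg ν)
  have h6 : (Kp + |ν| * KL) * ∫ x, ‖U x‖ ≤ (Kp + |ν| * KL) * (2⁻¹ * (1 + ∫ x, ‖U x‖ ^ 2)) :=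
    mul_le_mul_of_nonneg_left b4 (by positivity)
  nlinarith

/-- **Integrability on `(0, ∞)` of the weak-form functional of a field in the Leray class.** If
`w` is space–time measurable on `(0, ∞) × T^d`, locally square integrable, essentially bounded
in `L²(T^d)` (`∫‖w(t)‖² ≤ C < ∞` for a.e. `t > 0`), and `ψ` is a test field (vanishing for large
times), then `t ↦ ∫ (⟪w, ∂ₜψ⟫ + ⟪w, (w·∇)ψ⟫ - ν⟪w, (-Δ)^α ψ⟫)(t)` is integrable on `(0, ∞)`: it is
measurable (Fubini), bounded by a constant on the time support of `ψ` (`abs_fracWeakFunctional_slice_le`)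
and zero beyond it. This is what makes the Bochner integral in the weak formulation with datum
(`Torus.IsWeakFracNSSolutionWithData`) a genuine integral for Leray solutions. [folklore] -/
theorem integrableOn_fracWeakFunctional_Ioi (hα : 0 ≤ α)
    (hm : AEStronglyMeasurable (FunctionSpaces.Torus.stLift w) (volume.restrict (Ioi 0 ×ˢ univ)))
    (hloc : ∀ S : ℝ, ∫⁻ t in Ioo 0 S, ∫⁻ x, ‖w t x‖ₑ ^ 2 < ⊤)
    (hbdd : ∃ C : ℝ≥0∞, C < ⊤ ∧ ∀ᵐ t ∂(volume.restrict (Ioi 0)), eL2NormSq (w t) ≤ C)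
    (hψ : FunctionSpaces.Torus.IsSpaceTimeTest S₀ ψ) :
    IntegrableOn (fun t => ∫ x, (⟪w t x, FunctionSpaces.Torus.timeDeriv ψ t x⟫_ℝ +
      ⟪w t x, FunctionSpaces.Torus.convect (w t) (ψ t) x⟫_ℝ - ν * ⟪w t x, fracLaplacian α (ψ t) x⟫_ℝ)) (Ioi 0) := by
  -- the time support of the test data
  obtain ⟨S', -, hS'⟩ := hψ.2
  obtain ⟨S'', -, hS''⟩ := hψ.timeDeriv.2
  set S₁ : ℝ := max (max S' S'') 1 with hS₁
  have hzero : ∀ t, S₁ ≤ t → (∫ x, (⟪w t x, FunctionSpaces.Torus.timeDeriv ψ t x⟫_ℝ +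
      ⟪w t x, FunctionSpaces.Torus.convect (w t) (ψ t) x⟫_ℝ - ν * ⟪w t x, fracLaplacian α (ψ t) x⟫_ℝ)) = 0 := by
    intro t ht
    have h1 : ψ t = 0 := hS' t ((le_max_left _ _).trans ((le_max_left _ _).trans ht))
    have h2 : FunctionSpaces.Torus.timeDeriv ψ t = 0 :=
      hS'' t ((le_max_right _ _).trans ((le_max_left _ _).trans ht))
    simp [h1, h2, convect_pi_zero_right, fracLaplacian_zero_fun]
  -- uniform bounds for the test data on `[0, S₁ + 1]`
  have hψ₁ : FunctionSpaces.Torus.IsSpaceTimeTest (S₁ + 1) ψ :=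
    ⟨hψ.1, S', by linarith [le_max_left (max S' S'') 1, le_max_left S' S''], hS'⟩
  obtain ⟨Kp, -, -, C, hC0, hKp, -, -, hC⟩ := hψ₁.exists_bounds
  obtain ⟨M, hM0, hM⟩ := exists_norm_fracLaplacian_le hα (hψ.isSmoothSpaceTimeOn univ)
    (isCompact_Icc (a := (0 : ℝ)) (b := S₁ + 1))
  have hKp0 : 0 ≤ Kp := (norm_nonneg _).trans (hKp 0 ⟨le_rfl, by positivity⟩ 0)
  -- a.e. slice data
  obtain ⟨Cw, hCw, hbd⟩ := hbdd
  have hmem : ∀ᵐ t ∂(volume.restrict (Ioi (0 : ℝ))), t ∈ Ioo 0 (S₁ + 1) → MemLp (w t) 2 volume := by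
    have h := FunctionSpaces.Torus.ae_memLp_slice hm (hloc (S₁ + 1))
    rw [ae_restrict_iff' measurableSet_Ioo] at h
    exact ae_restrict_of_ae h
  -- domination by a constant on `(0, S₁]`, zero beyond
  set B : ℝ := (Kp + |ν| * M) * (2⁻¹ * (1 + Cw.toReal)) + C * Cw.toReal with hB
  refine Integrable.mono' (g := (Ioc 0 S₁).indicator fun _ => B) ?_
    (aestronglyMeasurable_fracWeakFunctional hα hm hψ) ?_
  · exact (integrableOn_const (measure_Ioc_lt_top (a := (0 : ℝ)) (b := S₁)).ne).integrable_indicator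
      measurableSet_Ioc
  · filter_upwards [hbd, hmem, ae_restrict_mem measurableSet_Ioi] with t hbt hmt ht0
    by_cases htS : t ≤ S₁
    · have htI : t ∈ Icc 0 (S₁ + 1) := ⟨le_of_lt ht0, by linarith⟩
      have hU : MemLp (w t) 2 volume := hmt ⟨ht0, by linarith⟩
      rw [indicator_of_mem (show t ∈ Ioc 0 S₁ from ⟨ht0, htS⟩), Real.norm_eq_abs]
      have hI2 : ∫ x, ‖w t x‖ ^ 2 ≤ Cw.toReal := by
        have h := hbt
        rw [eL2NormSq, lintegral_enorm_sq_eq_ofReal hU] at h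
        exact (ENNReal.ofReal_le_iff_le_toReal hCw.ne).1 h
      refine (abs_fracWeakFunctional_slice_le hU (hψ.isSmooth_slice t)
        (hψ.timeDeriv.isSmooth_slice t).continuous (continuous_fracLaplacian hα (hψ.isSmooth_slice t))
        (hC t htI) (hKp t htI) (hM t htI) ν).trans ?_
      rw [hB]
      have hcoef : 0 ≤ Kp + |ν| * M := by positivity
      nlinarith [mul_le_mul_of_nonneg_left hI2 hcoef, mul_le_mul_of_nonneg_left hI2 hC0]
    · rw [hzero t (le_of_not_ge htS), norm_zero]
      refine indicator_nonneg (fun s _ => ?_) t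
      rw [hB]
      have h1 : 0 ≤ Cw.toReal := ENNReal.toReal_nonneg
      positivity

end LerayClass

/-! ## The `H^α` norm against the `L²` norm and the fractional dissipation -/

section Sobolev

omit [DecidableEq d] in
/-- Off the zero mode the inhomogeneous weight is dominated by the symbol of `(-Δ)^α`:
`(1 + |k|²)^α ≤ (4π²|k|²)^α` for `k ≠ 0`, `α ≥ 0` (`1 + |k|² ≤ 2|k|² ≤ 4π²|k|²`). [folklore] -/
theorem sobolevWeight_sq_le_fracSymbol {α : ℝ} (hα : 0 ≤ α) {k : d → ℤ} (hk : k ≠ 0) :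
    FunctionSpaces.Torus.sobolevWeight α k ^ 2 ≤ fracSymbol α k := by
  -- `1 ≤ |k|²` for the nonzero integer frequency `k`
  have hq : 1 ≤ FunctionSpaces.Torus.freqNormSq k := by
    obtain ⟨i, hi⟩ : ∃ i, k i ≠ 0 := Function.ne_iff.1 hk
    have h1 : (1 : ℝ) ≤ (k i : ℝ) ^ 2 := by
      have : (1 : ℤ) ≤ (k i) ^ 2 := by
        have := Int.one_le_abs hi
        nlinarith [sq_abs (k i)]
      exact_mod_cast this
    exact h1.trans (Finset.single_le_sum (f := fun j => (k j : ℝ) ^ 2) (fun j _ => sq_nonneg _)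
      (Finset.mem_univ i))
  rw [FunctionSpaces.Torus.sobolevWeight, ← Real.rpow_natCast,
    ← Real.rpow_mul (by linarith), show α / 2 * ((2 : ℕ) : ℝ) = α by push_cast; ring, fracSymbol]
  refine Real.rpow_le_rpow (by linarith) ?_ hα
  have hπ : (1 : ℝ) ≤ Real.pi ^ 2 := by nlinarith [Real.pi_gt_three]
  have h1 : FunctionSpaces.Torus.freqNormSq k ≤ Real.pi ^ 2 * FunctionSpaces.Torus.freqNormSq k := by
    have := mul_le_mul_of_nonneg_right hπ (by linarith : (0 : ℝ) ≤ FunctionSpaces.Torus.freqNormSq k)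
    linarith
  linarith

omit [DecidableEq d] in
/-- The fractional dissipation as a Fourier sum:
`∫|(-Δ)^{α/2}v|² = ∑_{k ≠ 0} (4π²|k|²)^α ‖v̂(k)‖²` in `[0, ∞]`. [folklore] -/
theorem eFracDissipation_eq_tsum (α : ℝ) (v : UnitAddTorus d → EuclideanSpace ℝ d) :
    eFracDissipation α v = ∑' k : d → ℤ, (if k = 0 then 0 else ENNReal.ofReal (fracSymbol α k)) *
      ‖mFourierCoeff (FunctionSpaces.EuclideanSpace.complexify ∘ v) k‖ₑ ^ 2 := by
  rw [eFracDissipation, FunctionSpaces.Torus.eHomSobolevSeminorm, ENNReal.rpow_half_sq, ← ENNReal.tsum_mul_left]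
  refine tsum_congr fun k => ?_
  split_ifs with hk
  · simp
  · rw [← mul_assoc, ← ENNReal.ofReal_mul (Real.rpow_nonneg (by positivity) α), fracSymbol,
      Real.mul_rpow (by positivity) (FunctionSpaces.Torus.freqNormSq_nonneg k)]

omit [DecidableEq d] in
/-- **`H^α` is controlled by `L²` and the fractional dissipation**: for `v ∈ L²(T^d; ℝ^d)` and
`α ≥ 0`, `‖complexify ∘ v‖²_{H^α} ≤ ∫⁻ ‖v‖ₑ² + ∫|(-Δ)^{α/2}v|²` (Parseval for the zero-order part,
`sobolevWeight_sq_le_fracSymbol` mode by mode). This is the inequality by which the energy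
inequality of a Leray solution yields its `L²_t H^α_x` regularity. [folklore] -/
theorem eSobolevNorm_sq_le_add_eFracDissipation {α : ℝ} (hα : 0 ≤ α)
    {v : UnitAddTorus d → EuclideanSpace ℝ d} (hv : MemLp v 2 volume) :
    FunctionSpaces.Torus.eSobolevNorm α (FunctionSpaces.EuclideanSpace.complexify ∘ v) ^ 2 ≤
      (∫⁻ x, ‖v x‖ₑ ^ 2) + eFracDissipation α v := by
  rw [FunctionSpaces.Torus.eSobolevNorm, ENNReal.rpow_half_sq,
    ← FunctionSpaces.Torus.tsum_enorm_sq_mFourierCoeff_complexify hv, eFracDissipation_eq_tsum,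
    ← ENNReal.tsum_add]
  refine ENNReal.tsum_le_tsum fun k => ?_
  by_cases hk : k = 0
  · subst hk
    simp
  · rw [if_neg hk]
    calc ENNReal.ofReal (FunctionSpaces.Torus.sobolevWeight α k ^ 2) *
          ‖mFourierCoeff (FunctionSpaces.EuclideanSpace.complexify ∘ v) k‖ₑ ^ 2
        ≤ ENNReal.ofReal (fracSymbol α k) * ‖mFourierCoeff (FunctionSpaces.EuclideanSpace.complexify ∘ v) k‖ₑ ^ 2 :=
          mul_le_mul' (ENNReal.ofReal_le_ofReal (sobolevWeight_sq_le_fracSymbol hα hk)) le_rfl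
      _ ≤ _ := le_add_self

omit [DecidableEq d] in
/-- **Time-measurability of the fractional dissipation** of a field whose Fourier coefficients
are a.e.-strongly measurable in time (a countable sum of measurable functions). [folklore] -/
theorem aemeasurable_eFracDissipation_of_coeff {μ : Measure ℝ} {w : ℝ → UnitAddTorus d → EuclideanSpace ℝ d}
    (hw : ∀ k, AEStronglyMeasurable (fun t => mFourierCoeff (FunctionSpaces.EuclideanSpace.complexify ∘ w t) k) μ)
    (α : ℝ) : AEMeasurable (fun t => eFracDissipation α (w t)) μ := by
  have h : (fun t => eFracDissipation α (w t)) = fun t => ∑' k : d → ℤ,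
      (if k = 0 then 0 else ENNReal.ofReal (fracSymbol α k)) *
        ‖mFourierCoeff (FunctionSpaces.EuclideanSpace.complexify ∘ w t) k‖ₑ ^ 2 :=
    funext fun t => eFracDissipation_eq_tsum α (w t)
  rw [h]
  exact AEMeasurable.tsum fun k => ((hw k).enorm.pow_const 2).const_mul _

end Sobolev


/-! ## Gluing a continuous local solution with a Leray continuation -/

section Glue

variable {T α : ℝ} {v w : ℝ → UnitAddTorus d → EuclideanSpace ℝ d}

omit [DecidableEq d] in
/-- **Weak incompressibility survives at every time of the closed slab.** If `v` is continuous on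
`[0, T] × T^d` (`0 < T`) and `v t` is weakly divergence free for a.e. `t ∈ (0, T)`, then `v t` is
weakly divergence free for every `t ∈ [0, T]`: for a smooth `θ`, `t ↦ ∫⟪v t, ∇θ⟫` is continuous
on `[0, T]` and vanishes a.e. on `(0, T)`, hence on `[0, T] = closure (0, T)`. (General-dimension
form of the lemma used for the datum `v(T)` of the continuation.) [folklore] -/
theorem isWeaklyDivFree_of_continuousOn_slab (hT : 0 < T)
    (hc : ContinuousOn (uncurry v) (Icc 0 T ×ˢ univ))
    (hae : ∀ᵐ t ∂(volume.restrict (Ioo 0 T)), FunctionSpaces.Torus.IsWeaklyDivFree (v t)) {t₀ : ℝ}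
    (ht₀ : t₀ ∈ Icc 0 T) : FunctionSpaces.Torus.IsWeaklyDivFree (v t₀) := by
  intro θ hθ
  set vc : ℝ → UnitAddTorus d → EuclideanSpace ℝ d := fun t x => v (projIcc 0 T hT.le t) x with hvc_def
  have hvc : ∀ t ∈ Icc 0 T, vc t = v t := fun t ht => by
    funext x
    simp [hvc_def, projIcc_of_mem hT.le ht]
  have hvcc : Continuous (uncurry vc) := by
    have h1 : Continuous fun p : ℝ × UnitAddTorus d => ((projIcc 0 T hT.le p.1 : ℝ), p.2) :=
      (continuous_subtype_val.comp (continuous_projIcc.comp continuous_fst)).prodMk continuous_snd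
    exact hc.comp_continuous h1 fun p => ⟨(projIcc 0 T hT.le p.1).2, mem_univ _⟩
  set G : ℝ → ℝ := fun t => ∫ x, ⟪vc t x, FunctionSpaces.Torus.gradient θ x⟫_ℝ with hG_def
  have hGc : Continuous G := by
    have hF : Continuous fun p : ℝ × UnitAddTorus d => ⟪vc p.1 p.2, FunctionSpaces.Torus.gradient θ p.2⟫_ℝ :=
      hvcc.inner (hθ.gradient.continuous.comp continuous_snd)
    simpa only [Measure.restrict_univ] using
      continuous_parametric_integral_of_continuous hF isCompact_univ
  have hG0 : G =ᵐ[volume.restrict (Ioo 0 T)] fun _ => (0 : ℝ) := by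
    filter_upwards [hae, ae_restrict_mem measurableSet_Ioo] with t ht htI
    show (∫ x, ⟪vc t x, FunctionSpaces.Torus.gradient θ x⟫_ℝ) = 0
    rw [hvc t (Ioo_subset_Icc_self htI)]
    exact ht θ hθ
  have hEq : EqOn G (fun _ => (0 : ℝ)) (Ioo 0 T) :=
    Measure.eqOn_open_of_ae_eq hG0 isOpen_Ioo hGc.continuousOn continuousOn_const
  have hEq' : EqOn G (fun _ => (0 : ℝ)) (Icc 0 T) := by
    have h := hEq.closure hGc continuous_const
    rwa [closure_Ioo hT.ne] at h
  have h0 : G t₀ = 0 := hEq' ht₀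
  simpa [hG_def, hvc t₀ ht₀] using h0

/-- **Gluing a continuous local solution with a Leray continuation** (the Lean content of
Colombo–De Lellis–De Rosa 2018, §1, p. 3: "Each solution in Theorem 1.3 can be prolonged past the
time `T` using Theorem 1.1 (note that (NS) is invariant under time-shifts and so Theorem 1.1 is
valid with any initial time `T` substituting `0`)"; De Rosa 2019, end of the proof of Thm. 1.2).
Let `α ≥ 0`, `T > 0`, let `v` be continuous on `[0, T] × T^d`, a distributional solution of the
fractional system on `T^d × (0, T)` (`Torus.IsWeakFracNSSolutionOn T α 1 v`) obeying the energy
inequality `½∫|v(t)|² + ∫ₛᵗ∫|(-Δ)^{α/2}v|² ≤ ½∫|v(s)|²` for all `0 ≤ s < t ≤ T`, and let `w` be a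
Leray solution from the final slice `v(T)` (`Torus.IsLerayFracSolution α (v T) w`, time counted
from `0`). Then the concatenation `u(t) = v(t)` (`t ≤ T`), `u(t) = w(t - T)` (`t > T`) is a Leray
solution from `v(0)`. Ingredients: measurability of the glued lift (piecewise, the shear
`(t, y) ↦ (t - T, y)` being measure preserving); the energy inequalities by splitting the
dissipation integral at `T` and translating (`setLIntegral_Ioo_comp_sub_right`), whence the
`L^∞L²` bound `∫|u(t)|² ≤ ∫|v(0)|²` and, with `eSobolevNorm_sq_le_add_eFracDissipation` and the
time-measurability of the dissipation, the class `L²_loc H^α`; and the weak formulation with datum,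
obtained from the end-point identity `IsWeakFracNSSolutionOn.setIntegral_Ioc_eq_sub` on `[0, T]`
and the translated identity of `w` on `[T, ∞)` (its functional being integrable,
`integrableOn_fracWeakFunctional_Ioi`), the boundary terms `∫⟪v(T), ψ(T)⟫` cancelling.
[cite: ColomboDelellisDerosa2018, §1 p. 3 (paragraph after Thm. 1.3)] -/
theorem IsLerayFracSolution.glue (hT : 0 < T) (hα : 0 ≤ α)
    (hc : ContinuousOn (uncurry v) (Icc 0 T ×ˢ univ)) (hw : IsWeakFracNSSolutionOn T α 1 v)
    (hE : ∀ s t : ℝ, 0 ≤ s → s < t → t ≤ T → FracEnergyIneq α v s t)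
    (hW : IsLerayFracSolution α (v T) w) :
    IsLerayFracSolution α (v 0) (fun t => if t ≤ T then v t else w (t - T)) := by
  set u : ℝ → UnitAddTorus d → EuclideanSpace ℝ d := fun t => if t ≤ T then v t else w (t - T)
    with hu_def
  have hu_le : ∀ {t : ℝ}, t ≤ T → u t = v t := fun ht => by simp [hu_def, ht]
  have hu_gt : ∀ {t : ℝ}, T < t → u t = w (t - T) := fun ht => by simp [hu_def, not_le.2 ht]
  obtain ⟨⟨hWm, hWloc, hWdiv, hWweak⟩, hWbdd, hWsob, hWE0, hWEae⟩ := hW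
  -- the local piece
  have hv' := continuousOn_stLift_of_continuousOn_uncurry hc
  have hvL2 : ∀ {t : ℝ}, t ∈ Icc 0 T → MemLp (v t) 2 volume := fun ht =>
    (continuous_slice_of_continuousOn_uncurry hc ht).memLp_of_hasCompactSupport
      (HasCompactSupport.of_compactSpace _)
  have hv0fin : eL2NormSq (v 0) < ⊤ := by
    rw [eL2NormSq, lintegral_enorm_sq_eq_ofReal (hvL2 ⟨le_rfl, hT.le⟩)]
    exact ENNReal.ofReal_lt_top
  have hE' : ∀ s t : ℝ, 0 ≤ s → s ≤ t → t ≤ T → FracEnergyIneq α v s t := by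
    intro s t hs hst htT
    rcases hst.eq_or_lt with rfl | hlt
    · simp [FracEnergyIneq]
    · exact hE s t hs hlt htT
  -- dissipation integrals of `u`
  have hDv : ∀ a b : ℝ, b ≤ T →
      ∫⁻ τ in Ioo a b, eFracDissipation α (u τ) = ∫⁻ τ in Ioo a b, eFracDissipation α (v τ) :=
    fun a b hb => setLIntegral_congr_fun measurableSet_Ioo fun τ hτ => by rw [hu_le (hτ.2.le.trans hb)]
  have hDw : ∀ a b : ℝ, T ≤ a → ∫⁻ τ in Ioo a b, eFracDissipation α (u τ) =
      ∫⁻ τ in Ioo (a - T) (b - T), eFracDissipation α (w τ) := by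
    intro a b ha
    rw [← setLIntegral_Ioo_comp_sub_right (fun τ => eFracDissipation α (w τ)) (a - T) (b - T) T,
      sub_add_cancel, sub_add_cancel]
    exact setLIntegral_congr_fun measurableSet_Ioo fun τ hτ => by rw [hu_gt (lt_of_le_of_lt ha hτ.1)]
  have hsplit : ∀ s t : ℝ, s ≤ T → T < t → ∫⁻ τ in Ioo s t, eFracDissipation α (u τ) =
      (∫⁻ τ in Ioo s T, eFracDissipation α (v τ)) + ∫⁻ τ in Ioo 0 (t - T), eFracDissipation α (w τ) := by
    intro s t hs ht
    rw [← Ioc_union_Ioo_eq_Ioo hs ht, lintegral_union measurableSet_Ioo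
      (Set.disjoint_left.2 fun x hx hx' => lt_irrefl T (lt_of_lt_of_le hx'.1 hx.2)),
      setLIntegral_congr (Ioo_ae_eq_Ioc (μ := (volume : Measure ℝ)) (a := s) (b := T)).symm,
      hDv s T le_rfl, hDw T t le_rfl, sub_self]
  -- the energy inequality across `T`
  have hkey : ∀ s t : ℝ, 0 ≤ s → s ≤ T → T < t → FracEnergyIneq α u s t := by
    intro s t hs hsT hTt
    unfold FracEnergyIneq
    rw [hsplit s t hsT hTt, hu_gt hTt, hu_le hsT]
    have h1 := hWE0 (t - T) (by linarith)
    have h2 := hE' s T hs hsT le_rfl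
    unfold FracEnergyIneq at h2
    calc 2⁻¹ * eL2NormSq (w (t - T)) + ((∫⁻ τ in Ioo s T, eFracDissipation α (v τ)) +
          ∫⁻ τ in Ioo 0 (t - T), eFracDissipation α (w τ))
        = (2⁻¹ * eL2NormSq (w (t - T)) + ∫⁻ τ in Ioo 0 (t - T), eFracDissipation α (w τ)) +
            ∫⁻ τ in Ioo s T, eFracDissipation α (v τ) := by
          rw [add_comm (∫⁻ τ in Ioo s T, eFracDissipation α (v τ)), add_assoc]
      _ ≤ 2⁻¹ * eL2NormSq (v T) + ∫⁻ τ in Ioo s T, eFracDissipation α (v τ) := add_le_add h1 le_rfl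
      _ ≤ 2⁻¹ * eL2NormSq (v s) := h2
  -- the energy inequality from `0`
  have hE0u : ∀ t : ℝ, 0 ≤ t →
      2⁻¹ * eL2NormSq (u t) + ∫⁻ τ in Ioo 0 t, eFracDissipation α (u τ) ≤ 2⁻¹ * eL2NormSq (v 0) := by
    intro t ht
    rcases le_or_gt t T with htT | hTt
    · rw [hu_le htT, hDv 0 t htT]
      exact hE' 0 t le_rfl ht htT
    · have h := hkey 0 t le_rfl hT.le hTt
      unfold FracEnergyIneq at h
      rwa [hu_le hT.le] at h
  -- the `L^∞L²` bound
  have hbound : ∀ t : ℝ, 0 ≤ t → eL2NormSq (u t) ≤ eL2NormSq (v 0) := by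
    intro t ht
    have h2 : 2⁻¹ * eL2NormSq (u t) ≤ 2⁻¹ * eL2NormSq (v 0) := le_trans le_self_add (hE0u t ht)
    exact (ENNReal.mul_le_mul_iff_right (by simp) (by simp)).1 h2
  -- measurability of the glued lift
  have hmeas : AEStronglyMeasurable (FunctionSpaces.Torus.stLift u) (volume.restrict (Ioi 0 ×ˢ univ)) := by
    classical
    have hpw : FunctionSpaces.Torus.stLift u = (Iic T ×ˢ (univ : Set (EuclideanSpace ℝ d))).piecewise
        (FunctionSpaces.Torus.stLift v) (FunctionSpaces.Torus.stLift fun t => w (t - T)) := by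
      funext p
      by_cases hp : p.1 ≤ T
      · rw [piecewise_eq_of_mem _ _ _ (show p ∈ Iic T ×ˢ (univ : Set (EuclideanSpace ℝ d)) from
          ⟨hp, mem_univ _⟩)]
        simp [FunctionSpaces.Torus.stLift, hu_le hp]
      · rw [piecewise_eq_of_notMem _ _ _ (fun h => hp (mem_prod.1 h).1)]
        simp [FunctionSpaces.Torus.stLift, hu_gt (not_le.1 hp)]
    rw [hpw]
    refine AEStronglyMeasurable.piecewise (measurableSet_Iic.prod MeasurableSet.univ) ?_ ?_
    · rw [Measure.restrict_restrict (measurableSet_Iic.prod MeasurableSet.univ), Set.prod_inter_prod,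
        univ_inter, Iic_inter_Ioi]
      exact (hv'.mono (prod_mono Ioc_subset_Icc_self subset_rfl)).aestronglyMeasurable
        (measurableSet_Ioc.prod MeasurableSet.univ)
    · have hcompl : (Iic T ×ˢ (univ : Set (EuclideanSpace ℝ d)))ᶜ = Ioi T ×ˢ univ := by
        ext p
        simp [not_le]
      rw [hcompl, Measure.restrict_restrict (measurableSet_Ioi.prod MeasurableSet.univ), Set.prod_inter_prod,
        univ_inter, Ioi_inter_Ioi, max_eq_left hT.le]
      have hcomp : (FunctionSpaces.Torus.stLift fun t => w (t - T)) =
          FunctionSpaces.Torus.stLift w ∘ Prod.map (fun t : ℝ => t - T) id := by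
        funext p
        rfl
      rw [hcomp]
      exact hWm.comp_measurePreserving (measurePreserving_prodMap_sub_right_Ioi T)
  -- local square integrability
  have hlocu : ∀ S : ℝ, ∫⁻ t in Ioo 0 S, ∫⁻ x, ‖u t x‖ₑ ^ 2 < ⊤ := by
    intro S
    calc ∫⁻ t in Ioo 0 S, ∫⁻ x, ‖u t x‖ₑ ^ 2 ≤ ∫⁻ _ in Ioo 0 S, eL2NormSq (v 0) :=
          setLIntegral_mono' measurableSet_Ioo fun t ht => hbound t ht.1.le
      _ < ⊤ := by
          rw [setLIntegral_const]
          exact ENNReal.mul_lt_top hv0fin measure_Ioo_lt_top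
  -- weak incompressibility for a.e. `t > 0`
  have hdivu : ∀ᵐ t ∂(volume.restrict (Ioi 0)), FunctionSpaces.Torus.IsWeaklyDivFree (u t) := by
    have h1 : ∀ᵐ t ∂(volume.restrict (Ioc 0 T)), FunctionSpaces.Torus.IsWeaklyDivFree (u t) := by
      rw [← restrict_Ioo_eq_restrict_Ioc]
      filter_upwards [hw.2.2.1, ae_restrict_mem measurableSet_Ioo] with t ht htI
      rwa [hu_le htI.2.le]
    have h2 : ∀ᵐ t ∂(volume.restrict (Ioi T)), FunctionSpaces.Torus.IsWeaklyDivFree (u t) := by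
      filter_upwards [ae_restrict_Ioi_comp_sub_right T hWdiv, ae_restrict_mem measurableSet_Ioi]
        with t ht htT
      rwa [hu_gt (mem_Ioi.1 htT)]
    have h := (ae_restrict_union_iff (Ioc 0 T) (Ioi T) _).2 ⟨h1, h2⟩
    rwa [Ioc_union_Ioi_eq_Ioi hT.le] at h
  -- the class `L²_loc H^α`
  have hsob : ∀ S : ℝ, 0 < S →
      FunctionSpaces.Torus.MemL2Sobolev 0 S α (fun t => FunctionSpaces.EuclideanSpace.complexify ∘ u t) := by
    intro S hS
    have hcoef := fun k => FunctionSpaces.Torus.aestronglyMeasurable_mFourierCoeff_stSlice hmeas S k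
    have hDm : AEMeasurable (fun t => eFracDissipation α (u t)) (volume.restrict (Ioo 0 S)) :=
      aemeasurable_eFracDissipation_of_coeff hcoef α
    have hDfin : ∫⁻ t in Ioo 0 S, eFracDissipation α (u t) < ⊤ :=
      lt_of_le_of_lt (le_trans le_add_self (hE0u S hS.le)) (ENNReal.mul_lt_top (by simp) hv0fin)
    have hmemS : ∀ᵐ t ∂(volume.restrict (Ioo 0 S)), MemLp (u t) 2 volume :=
      FunctionSpaces.Torus.ae_memLp_slice hmeas (hlocu S)
    refine ⟨?_, ?_⟩
    · filter_upwards [hmemS, ae_lt_top' hDm hDfin.ne, ae_restrict_mem measurableSet_Ioo] with t hmt hDt ht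
      refine ⟨FunctionSpaces.Torus.integrable_complexify_comp (hmt.integrable one_le_two), ?_⟩
      have h := eSobolevNorm_sq_le_add_eFracDissipation hα hmt
      have hfin : (∫⁻ x, ‖u t x‖ₑ ^ 2) + eFracDissipation α (u t) < ⊤ :=
        ENNReal.add_lt_top.2 ⟨lt_of_le_of_lt (hbound t ht.1.le) hv0fin, hDt⟩
      have h2 := lt_of_le_of_lt h hfin
      by_contra htop
      rw [not_lt, top_le_iff] at htop
      rw [htop, ENNReal.top_pow two_ne_zero] at h2
      exact lt_irrefl _ h2
    · rw [FunctionSpaces.Torus.eL2SobolevNorm]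
      refine ENNReal.rpow_lt_top_of_nonneg (by norm_num) (lt_top_iff_ne_top.1 ?_)
      calc ∫⁻ t in Ioo 0 S, FunctionSpaces.Torus.eSobolevNorm α (FunctionSpaces.EuclideanSpace.complexify ∘ u t) ^ 2
          ≤ ∫⁻ t in Ioo 0 S, ((∫⁻ x, ‖u t x‖ₑ ^ 2) + eFracDissipation α (u t)) :=
            lintegral_mono_ae (hmemS.mono fun t ht => eSobolevNorm_sq_le_add_eFracDissipation hα ht)
        _ ≤ ∫⁻ t in Ioo 0 S, (eL2NormSq (v 0) + eFracDissipation α (u t)) :=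
            setLIntegral_mono' measurableSet_Ioo fun t ht => add_le_add (hbound t ht.1.le) le_rfl
        _ = (∫⁻ _ in Ioo 0 S, eL2NormSq (v 0)) + ∫⁻ t in Ioo 0 S, eFracDissipation α (u t) :=
            lintegral_add_left' aemeasurable_const _
        _ < ⊤ := by
            rw [setLIntegral_const]
            exact ENNReal.add_lt_top.2 ⟨ENNReal.mul_lt_top hv0fin measure_Ioo_lt_top, hDfin⟩
  -- the energy inequality from a.e. `s > 0`
  have hEae : ∀ᵐ s ∂(volume.restrict (Ioi 0)), ∀ t : ℝ, s < t → FracEnergyIneq α u s t := by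
    have h1 : ∀ᵐ s ∂(volume.restrict (Ioc 0 T)), ∀ t : ℝ, s < t → FracEnergyIneq α u s t := by
      filter_upwards [ae_restrict_mem measurableSet_Ioc] with s hs t hst
      rcases le_or_gt t T with htT | hTt
      · unfold FracEnergyIneq
        rw [hu_le htT, hu_le hs.2, hDv s t htT]
        exact hE s t hs.1.le hst htT
      · exact hkey s t hs.1.le hs.2 hTt
    have h2 : ∀ᵐ s ∂(volume.restrict (Ioi T)), ∀ t : ℝ, s < t → FracEnergyIneq α u s t := by
      filter_upwards [ae_restrict_Ioi_comp_sub_right T hWEae, ae_restrict_mem measurableSet_Ioi]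
        with s hs hsT t hst
      have hTs : T < s := mem_Ioi.1 hsT
      have h := hs (t - T) (by linarith)
      unfold FracEnergyIneq at h ⊢
      rwa [hu_gt (hTs.trans hst), hu_gt hTs, hDw s t hTs.le]
    have h := (ae_restrict_union_iff (Ioc 0 T) (Ioi T) _).2 ⟨h1, h2⟩
    rwa [Ioc_union_Ioi_eq_Ioi hT.le] at h
  -- the weak formulation with datum `v 0`
  have hweak : ∀ ψ : ℝ → UnitAddTorus d → EuclideanSpace ℝ d,
      (∃ T', FunctionSpaces.Torus.IsSpaceTimeTest T' ψ) → FunctionSpaces.Torus.IsDivFreeTest ψ →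
      (∫ t in Ioi 0, ∫ x, (⟪u t x, FunctionSpaces.Torus.timeDeriv ψ t x⟫_ℝ +
        ⟪u t x, FunctionSpaces.Torus.convect (u t) (ψ t) x⟫_ℝ - 1 * ⟪u t x, fracLaplacian α (ψ t) x⟫_ℝ)) +
        ∫ x, ⟪v 0 x, ψ 0 x⟫_ℝ = 0 := by
    rintro ψ ⟨S, hψ⟩ hdivψ
    set ψ' : ℝ → UnitAddTorus d → EuclideanSpace ℝ d := fun τ => ψ (τ + T) with hψ'_def
    have hψ' : FunctionSpaces.Torus.IsSpaceTimeTest (S - T) ψ' := hψ.comp_add_right T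
    have hdiv' : FunctionSpaces.Torus.IsDivFreeTest ψ' := fun τ => hdivψ (τ + T)
    set Φu : ℝ → ℝ := fun t => ∫ x, (⟪u t x, FunctionSpaces.Torus.timeDeriv ψ t x⟫_ℝ +
      ⟪u t x, FunctionSpaces.Torus.convect (u t) (ψ t) x⟫_ℝ - 1 * ⟪u t x, fracLaplacian α (ψ t) x⟫_ℝ) with hΦu
    set Φv : ℝ → ℝ := fun t => ∫ x, (⟪v t x, FunctionSpaces.Torus.timeDeriv ψ t x⟫_ℝ +
      ⟪v t x, FunctionSpaces.Torus.convect (v t) (ψ t) x⟫_ℝ - 1 * ⟪v t x, fracLaplacian α (ψ t) x⟫_ℝ) with hΦv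
    set Φw : ℝ → ℝ := fun τ => ∫ x, (⟪w τ x, FunctionSpaces.Torus.timeDeriv ψ' τ x⟫_ℝ +
      ⟪w τ x, FunctionSpaces.Torus.convect (w τ) (ψ' τ) x⟫_ℝ - 1 * ⟪w τ x, fracLaplacian α (ψ' τ) x⟫_ℝ) with hΦw
    have hΦu_le : ∀ t ∈ Ioc 0 T, Φu t = Φv t := fun t ht => by
      simp only [hΦu, hΦv, hu_le ht.2]
    have hΦu_gt : ∀ t ∈ Ioi T, Φu t = Φw (t - T) := fun t ht => by
      simp only [hΦu, hΦw, hψ'_def, hu_gt (mem_Ioi.1 ht), timeDeriv_comp_add_right, sub_add_cancel]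
    -- integrability of the pieces
    have hIv : IntegrableOn Φv (Ioc 0 T) :=
      ((continuousOn_fracWeakFunctional hα hv' hψ).integrableOn_Icc).mono_set Ioc_subset_Icc_self
    have hIw : IntegrableOn Φw (Ioi 0) := integrableOn_fracWeakFunctional_Ioi hα hWm hWloc hWbdd hψ'
    have hIu1 : IntegrableOn Φu (Ioc 0 T) :=
      hIv.congr_fun (fun t ht => (hΦu_le t ht).symm) measurableSet_Ioc
    have hIu2 : IntegrableOn Φu (Ioi T) :=
      ((integrableOn_Ioi_comp_sub_right_iff Φw T).2 hIw).congr_fun (fun t ht => (hΦu_gt t ht).symm)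
        measurableSet_Ioi
    -- splitting at `T` and evaluating the two pieces
    have hsplitI : ∫ t in Ioi 0, Φu t = (∫ t in Ioc 0 T, Φu t) + ∫ t in Ioi T, Φu t := by
      rw [← Ioc_union_Ioi_eq_Ioi hT.le]
      exact setIntegral_union (Set.disjoint_left.2 fun t ht ht' => lt_irrefl T (lt_of_lt_of_le (mem_Ioi.1 ht') ht.2))
        measurableSet_Ioi hIu1 hIu2
    have hIv_val : ∫ t in Ioc 0 T, Φu t = (∫ x, ⟪v T x, ψ T x⟫_ℝ) - ∫ x, ⟪v 0 x, ψ 0 x⟫_ℝ := by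
      rw [setIntegral_congr_fun measurableSet_Ioc hΦu_le]
      exact hw.setIntegral_Ioc_eq_sub hT hα hc hψ hdivψ
    have hIw_val : ∫ t in Ioi T, Φu t = -∫ x, ⟪v T x, ψ T x⟫_ℝ := by
      rw [setIntegral_congr_fun measurableSet_Ioi hΦu_gt, setIntegral_Ioi_comp_sub_right Φw T]
      have h := hWweak ψ' ⟨S - T, hψ'⟩ hdiv'
      have h0 : ψ' 0 = ψ T := by simp [hψ'_def]
      rw [h0] at h
      linarith
    show (∫ t in Ioi 0, Φu t) + ∫ x, ⟪v 0 x, ψ 0 x⟫_ℝ = 0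
    rw [hsplitI, hIv_val, hIw_val]
    ring
  -- assembly
  refine ⟨⟨hmeas, hlocu, hdivu, hweak⟩, ⟨eL2NormSq (v 0), hv0fin, ?_⟩, hsob, hE0u, hEae⟩
  filter_upwards [ae_restrict_mem measurableSet_Ioi] with t ht using hbound t (le_of_lt (mem_Ioi.1 ht))

end Glue

end Torus

/-! ## The prolongation fact from Leray's existence theorem (CDLDR Thm. 1.1) -/

section Prolongation

/-- **Colombo–De Lellis–De Rosa 2018, the prolongation remark, from their Thm. 1.1** (§1 p. 3,
as printed: "Each solution in Theorem 1.3 can be prolonged past the time `T` using Theorem 1.1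
(note that (NS) is invariant under time-shifts and so Theorem 1.1 is valid with any initial time
`T` substituting `0`)"; De Rosa 2019, end of the proof of Thm. 1.2: "using Theorem 1.1, it is not
difficult to show that all these solutions can be prolonged to Leray–Hopf solutions for every
`t ≥ 0`"). Lean content: the named fact `ColomboDeLellisDeRosa2018_prolongation` follows from the
named fact `ColomboDeLellisDeRosa2018_thm11` (Leray's existence theorem for the fractional system,
CDLDR Thm. 1.1 with the remark following it). Proof: a space–time `C^β` field (`β > α > 0`) is
continuous on the closed slab, so its final slice `v(T)` is in `L²(𝕋³)` and — the incompressibility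
constraint holding for a.e. `t ∈ (0,T)` — weakly divergence free
(`Torus.isWeaklyDivFree_of_continuousOn_slab`); Thm. 1.1 gives a Leray solution `w` from `v(T)`,
and the concatenation of `v` with `w(· - T)` is a Leray solution from `v(0)` agreeing with `v` on
`[0, T]` (`Torus.IsLerayFracSolution.glue`). The Hölder regularity in space is not used beyond
continuity. [cite: ColomboDelellisDerosa2018, §1 p. 3 (paragraph after Thm. 1.3) and Thm. 1.1] -/
theorem ColomboDeLellisDeRosa2018_prolongation_of_thm11 (h11 : ColomboDeLellisDeRosa2018_thm11) :
    ColomboDeLellisDeRosa2018_prolongation := by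
  intro α β T hα hαβ hβ hT v hH hw hE
  obtain ⟨C, hC⟩ := hH
  have hr : 0 < Real.toNNReal β := Real.toNNReal_pos.2 (hα.trans hαβ)
  have hc : ContinuousOn (uncurry v) (Icc 0 T ×ˢ univ) := hC.continuousOn hr
  have hT2 : MemLp (v T) 2 volume :=
    (Torus.continuous_slice_of_continuousOn_uncurry hc ⟨hT.le, le_rfl⟩).memLp_of_hasCompactSupport
      (HasCompactSupport.of_compactSpace _)
  have hTdiv : FunctionSpaces.Torus.IsWeaklyDivFree (v T) :=
    Torus.isWeaklyDivFree_of_continuousOn_slab hT hc hw.2.2.1 ⟨hT.le, le_rfl⟩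
  obtain ⟨w, hW⟩ := h11 α hα (by linarith) (v T) hT2 hTdiv
  exact ⟨fun t => if t ≤ T then v t else w (t - T),
    Torus.IsLerayFracSolution.glue hT hα.le hc hw hE hW, fun t ht => by simp [ht.2]⟩

end Prolongation

end Literature.Analysis.FluidPDE
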